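import Summits.CriticalPhenomena.SAWScalingLimit.Theorems.LeftRightFKG.Negative.PAKitSound
import Summits.CriticalPhenomena.SAWScalingLimit.Theorems.LeftRightFKG.Negative.PAKitDict
import HarnessLib

/-!
# Negative knowledge on crux `LeftRightFKG`, part 17: `PAKit` soundness III — `checkAll ⟹ corner blocks`

Crux `stmt-CriticalPhenomena-11232`.  **`cornerBlock_of_checkAll`**: if the checker of part 14 accepts the
certified enumeration of the chord codes of a box instance `(Ω, 1, a, b)` on a window `[lo, hi]`, then at every
fugacity `x ∈ [lo, hi]` the chord type satisfies the corner-block hypothesis `hC` of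
`CornerLoc.pa_inst_of_cornerBlock` (part 13) VERBATIM — hence full left–right positive association of the instance
for all `≼`-up-closed events (composed per instance in parts 18+).

Proof outline (all inside one finite chord type): a block with `A` constant on the class is trivial
(`EndpointMonotone.bi_of_const`); otherwise the class has two distinct chords, so `k, m <` their length and the
checker visited the class's code set (`classOK_of_checkAll`, from `trie_sound` twice); `classOK_spec` yields linked
orders `No`, `Wo` of the realised next / previous steps; by `NextDet` / `PrevDet` membership in `A` / `B` is a function
of the row / column index, by linking + `lr_of_lrCode` + relative up-closedness it is MONOTONE in the index, hence an
upper interval (`exists_threshold`); the block's four sums regroup (`Finset.sum_fiberwise_of_maps_to`) into sums of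
the end-step matrix `Mx i j`, whose entries are the certified census polynomials evaluated at `x`
(`sum_filter_eq_listSum`, `Census.sum_pow_eq_census`, `PolyCert.evalR_realOf_eq_sum`) and which is `TP₂` on the
window by `tp2OK_spec` + `minorOK_sound`; `block_of_tp2` concludes.  Elementary ("folklore").
-/

namespace Summit.CriticalPhenomena.SAWScalingLimit.Theorems.LeftRightFKG.Negative.PAKit

open Literature.Analysis.ValidatedNumerics
open PolyMP (evalR addR mulR smulR posOn)
open PolyCert (realOf minorI)
open Census (censusList census)

/-! ## §8 The main soundness theorem: `checkAll ⟹ corner blocks` -/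

section Main

open Finset
open Literature.Probability.LatticeModels Literature.Probability.RandomPlanarGeometry
open CornerLoc (cls restrP IsUpOn NextDet PrevDet AgreeTo AgreeToR lr)
open scoped Classical

variable {Ω : Set ℂ} {a b : Site 2} {inV : ℤ × ℤ → Bool}
  (hB : ∀ x y : Site 2, (discreteDomainGraph Ω 1).Adj x y ↔
    (zdGraph 2).Adj x y ∧ inV (toZ2 x) = true ∧ inV (toZ2 y) = true)

/-- Class membership read on codes: `γ ∈ cls k π m σ` iff its code agrees with the code of a member `γe` at the
front positions `1..k` and the back positions `1..m` (position `0` is `a`, resp. `b`, for every chord). [folklore] -/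
theorem mem_cls_iff_code {k : ℕ} {π : ℕ → Site 2} {m : ℕ} {σ : ℕ → Site 2} {γe : SAW.DomainSAW Ω 1 a b}
    (he : γe ∈ cls k π m σ) (γ : SAW.DomainSAW Ω 1 a b) :
    γ ∈ cls k π m σ ↔
      agreeOn (getV (toZ2 b)) (γe.walk.support.map toZ2) (γ.walk.support.map toZ2) 0 k = true ∧
      agreeOn (getVR (toZ2 b)) (γe.walk.support.map toZ2) (γ.walk.support.map toZ2) 0 m = true := by
  obtain ⟨heA, heR⟩ : AgreeTo k π γe ∧ AgreeToR m σ γe := he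
  rw [agreeOn_iff, agreeOn_iff]
  simp only [getV_code, getVR_code]
  constructor
  · rintro ⟨hA, hR⟩
    exact ⟨fun i _ hi => by rw [hA i hi, heA i hi], fun j _ hj => by rw [hR j hj, heR j hj]⟩
  · rintro ⟨hA, hR⟩
    refine ⟨fun i hi => ?_, fun j hj => ?_⟩
    · rcases Nat.eq_zero_or_pos i with rfl | hpos
      · rw [SimpleGraph.Walk.getVert_zero, ← heA 0 (Nat.zero_le _), SimpleGraph.Walk.getVert_zero]
      · rw [← heA i hi]; exact toZ2_injective (hA i hpos hi)
    · rcases Nat.eq_zero_or_pos j with rfl | hpos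
      · rw [SimpleGraph.Walk.getVert_zero, ← heR 0 (Nat.zero_le _), SimpleGraph.Walk.getVert_zero]
      · rw [← heR j hj]; exact toZ2_injective (hR j hpos hj)

variable {g : Cfg} (hbz : g.bz = toZ2 b) (hN : ∀ γ : SAW.DomainSAW Ω 1 a b, γ.length ≤ g.N)
include hB hbz hN

/-- **The checker reaches every non-trivial class**: if `checkAll` accepts, the code class of any prefix/suffix class
with two distinct chords passes `classOK`. [folklore] -/
theorem classOK_of_checkAll (hcheck : checkAll g (codes inV g.N (toZ2 a) (toZ2 b)) = true)
    {k : ℕ} {π : ℕ → Site 2} {m : ℕ} {σ : ℕ → Site 2} {γe γn : SAW.DomainSAW Ω 1 a b}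
    (he : γe ∈ cls k π m σ) (hn : γn ∈ cls k π m σ) (hne : γe ≠ γn) :
    classOK g (((codes inV g.N (toZ2 a) (toZ2 b)).filter fun c =>
        agreeOn (getV g.bz) (γe.walk.support.map toZ2) c 0 k).filter fun c =>
        agreeOn (getVR g.bz) (γe.walk.support.map toZ2) c 0 m) k m = true := by
  obtain ⟨hk, hm⟩ := CornerLoc.EndpointMonotone.lt_length_of_ne he hn hne
  have hNe : γe.length ≤ g.N := hN γe
  have hce : γe.walk.support.map toZ2 ∈ codes inV g.N (toZ2 a) (toZ2 b) := Census.code_mem_enum hB hN γe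
  have hcn : γn.walk.support.map toZ2 ∈ codes inV g.N (toZ2 a) (toZ2 b) := Census.code_mem_enum hB hN γn
  have hne' : γe.walk.support.map toZ2 ≠ γn.walk.support.map toZ2 := fun h => hne (Census.code_injective h)
  obtain ⟨hnV, hnR⟩ := (mem_cls_iff_code he γn).1 hn
  obtain ⟨heV, heR⟩ := (mem_cls_iff_code he γe).1 he
  rw [← hbz] at hnV hnR heV heR
  -- outer trie: the prefix class of `γe`
  have h1 := trie_sound (getV g.bz) _ (g.N + 1) _ 0 hcheck _ hce k (Nat.zero_le _) (by omega)
    (two_le_length (List.mem_filter.2 ⟨hce, heV⟩) (List.mem_filter.2 ⟨hcn, hnV⟩) hne')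
  -- inner trie: the suffix class inside it
  have hce1 : γe.walk.support.map toZ2 ∈ (codes inV g.N (toZ2 a) (toZ2 b)).filter fun c =>
      agreeOn (getV g.bz) (γe.walk.support.map toZ2) c 0 k := List.mem_filter.2 ⟨hce, heV⟩
  have hcn1 : γn.walk.support.map toZ2 ∈ (codes inV g.N (toZ2 a) (toZ2 b)).filter fun c =>
      agreeOn (getV g.bz) (γe.walk.support.map toZ2) c 0 k := List.mem_filter.2 ⟨hcn, hnV⟩
  exact trie_sound (getVR g.bz) _ (g.N + 1) _ 0 h1 _ hce1 m (Nat.zero_le _) (by omega)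
    (two_le_length (List.mem_filter.2 ⟨hce1, heR⟩) (List.mem_filter.2 ⟨hcn1, hnR⟩) hne')

/-- **MAIN SOUNDNESS THEOREM.**  If the checker accepts the certified enumeration of the chord codes of the box
domain `Ω` (adjacency `hB`) between `a` and `b`, then at every fugacity `x` of the window the chord type has the
CORNER BLOCKS `hC` of `CornerLoc.pa_inst_of_cornerBlock` / `EndpointMonotone.bi_of_corner`: for every prefix/suffix
class, step restriction, next-step-determined relative up-set `A` and previous-step-determined relative up-set `B`,
`Z(Γ∩A)·Z(Γ∩B) ≤ Z(Γ)·Z(Γ∩A∩B)`.  Proof: trivial if `A` is constant on `Γ`; else the class has two chords, the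
checker visited its code class (`classOK_of_checkAll`); the linked orders make `A`, `B` upper intervals of the row /
column indices (`exists_threshold`, linking pairs are `≼`-comparable by `lr_of_lrCode`), the sums regroup into the
end-step matrix whose entries are the certified census polynomials, and `block_of_tp2` concludes. [folklore] -/
theorem cornerBlock_of_checkAll (ha : inV (toZ2 a) = true)
    (hbox : ∀ p, inV p = true → (g.X0 ≤ p.1 ∧ p.1 ≤ g.X1) ∧ (g.Y0 ≤ p.2 ∧ p.2 ≤ g.Y1))
    (hnodup : (codes inV g.N (toZ2 a) (toZ2 b)).Nodup)
    (hcheck : checkAll g (codes inV g.N (toZ2 a) (toZ2 b)) = true)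
    (hS : 0 < g.S) (hle : g.lo ≤ g.hi) (hlo0 : 0 ≤ g.lo) {x : ℝ} (hlo : (g.lo : ℝ) ≤ x) (hhi : x ≤ (g.hi : ℝ))
    [Fintype (SAW.DomainSAW Ω 1 a b)] :
    ∀ (k : ℕ) (π : ℕ → Site 2) (m : ℕ) (σ : ℕ → Site 2) (Sa Sb : Set (Site 2))
      (A B : Set (SAW.DomainSAW Ω 1 a b)) (s : Finset (SAW.DomainSAW Ω 1 a b)),
      s = univ.filter (· ∈ restrP k π m σ Sa Sb) → IsUpOn (cls k π m σ) A →
      IsUpOn (cls k π m σ) B → NextDet k A → PrevDet m B →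
      (∑ γ ∈ s.filter (· ∈ A), x ^ γ.length) * (∑ γ ∈ s.filter (· ∈ B), x ^ γ.length) ≤
        (∑ γ ∈ s, x ^ γ.length) * ∑ γ ∈ (s.filter (· ∈ A)).filter (· ∈ B), x ^ γ.length := by
  intro k π m σ Sa Sb A B s hs hAu hBu hNxt hPrv
  have hx : 0 ≤ x := le_trans (by exact_mod_cast hlo0) hlo
  have hw : ∀ γ ∈ s, 0 ≤ x ^ γ.length := fun γ _ => pow_nonneg hx _
  by_cases htriv : ∀ γ₁ ∈ s, ∀ γ₂ ∈ s, (γ₁ ∈ A ↔ γ₂ ∈ A)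
  · exact CornerLoc.EndpointMonotone.bi_of_const s _ A B hw htriv
  push Not at htriv
  obtain ⟨γe, hes, γn, hns, hen⟩ := htriv
  have hcls_of_s : ∀ γ ∈ s, γ ∈ cls k π m σ := fun γ hγ => by
    rw [hs] at hγ; exact (mem_filter.1 hγ).2.1
  have he := hcls_of_s γe hes
  have hne : γe ≠ γn := by
    rintro rfl
    rcases hen with ⟨h1, h2⟩ | ⟨h1, h2⟩
    exacts [h2 h1, h1 h2]
  -- the code class and what the checker delivers for it
  set L := codes inV g.N (toZ2 a) (toZ2 b) with hL
  set ce := γe.walk.support.map toZ2 with hce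
  set Q := L.filter fun c => agreeOn (getVR g.bz) ce c 0 m && agreeOn (getV g.bz) ce c 0 k with hQ
  have hOK : classOK g Q k m = true := by
    rw [hQ, ← List.filter_filter]
    exact classOK_of_checkAll hB hbz hN hcheck he (hcls_of_s γn hns) hne
  obtain ⟨No, Wo, hNo, hWo, htp⟩ := classOK_spec hOK
  obtain ⟨hlinkN, hndN, hmemN⟩ := findOrder_spec hNo
  obtain ⟨hlinkW, hndW, hmemW⟩ := findOrder_spec hWo
  -- dictionary
  have hmemQ : ∀ γ : SAW.DomainSAW Ω 1 a b, γ ∈ cls k π m σ ↔ γ.walk.support.map toZ2 ∈ Q := fun γ => by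
    rw [hQ, List.mem_filter, Bool.and_eq_true, mem_cls_iff_code he γ, ← hbz]
    exact ⟨fun ⟨h1, h2⟩ => ⟨Census.code_mem_enum hB hN γ, h2, h1⟩, fun ⟨_, h2, h1⟩ => ⟨h1, h2⟩⟩
  have hQL : ∀ c ∈ Q, c ∈ L := fun c hc => (List.mem_filter.1 hc).1
  have hnxt : ∀ γ : SAW.DomainSAW Ω 1 a b, getV g.bz (γ.walk.support.map toZ2) (k + 1) =
      toZ2 (γ.walk.getVert (k + 1)) := fun γ => by rw [hbz]; exact getV_code γ (k + 1)
  have hprv : ∀ γ : SAW.DomainSAW Ω 1 a b, getVR g.bz (γ.walk.support.map toZ2) (m + 1) =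
      toZ2 (γ.walk.reverse.getVert (m + 1)) := fun γ => by rw [hbz]; exact getVR_code γ (m + 1)
  -- the row and column indices of a chord
  set ι : SAW.DomainSAW Ω 1 a b → ℕ := fun γ => No.idxOf (toZ2 (γ.walk.getVert (k + 1))) with hι
  set κ : SAW.DomainSAW Ω 1 a b → ℕ := fun γ => Wo.idxOf (toZ2 (γ.walk.reverse.getVert (m + 1))) with hκ
  have hιlt : ∀ γ ∈ cls k π m σ, ι γ < No.length := fun γ hγ =>
    List.idxOf_lt_length_iff.2 (by rw [← hnxt]; exact hmemN _ ((hmemQ γ).1 hγ))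
  have hκlt : ∀ γ ∈ cls k π m σ, κ γ < Wo.length := fun γ hγ =>
    List.idxOf_lt_length_iff.2 (by rw [← hprv]; exact hmemW _ ((hmemQ γ).1 hγ))
  have hιeq : ∀ γ ∈ cls k π m σ, ∀ i < No.length,
      (ι γ = i ↔ toZ2 (γ.walk.getVert (k + 1)) = No.getD i g.bz) := fun γ hγ i hi => by
    constructor
    · rintro rfl
      rw [List.getD_eq_getElem _ _ (hιlt γ hγ), List.getElem_idxOf (hιlt γ hγ)]
    · intro h
      simp only [hι]
      rw [h, List.getD_eq_getElem _ _ hi, hndN.idxOf_getElem]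
  have hκeq : ∀ γ ∈ cls k π m σ, ∀ j < Wo.length,
      (κ γ = j ↔ toZ2 (γ.walk.reverse.getVert (m + 1)) = Wo.getD j g.bz) := fun γ hγ j hj => by
    constructor
    · rintro rfl
      rw [List.getD_eq_getElem _ _ (hκlt γ hγ), List.getElem_idxOf (hκlt γ hγ)]
    · intro h
      simp only [hκ]
      rw [h, List.getD_eq_getElem _ _ hj, hndW.idxOf_getElem]
  -- same index ⟹ same end step ⟹ same membership
  have hAι : ∀ γ ∈ cls k π m σ, ∀ γ' ∈ cls k π m σ, ι γ = ι γ' → (γ ∈ A ↔ γ' ∈ A) := by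
    intro γ hγ γ' hγ' hidx
    refine hNxt γ γ' (toZ2_injective ?_)
    rw [(hιeq γ hγ _ (hιlt γ' hγ')).1 hidx, ← (hιeq γ' hγ' _ (hιlt γ' hγ')).1 rfl]
  have hBκ : ∀ γ ∈ cls k π m σ, ∀ γ' ∈ cls k π m σ, κ γ = κ γ' → (γ ∈ B ↔ γ' ∈ B) := by
    intro γ hγ γ' hγ' hidx
    refine hPrv γ γ' (toZ2_injective ?_)
    rw [(hκeq γ hγ _ (hκlt γ' hγ')).1 hidx, ← (hκeq γ' hγ' _ (hκlt γ' hγ')).1 rfl]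
  -- chords realising a code of `Q`
  have hreal : ∀ c ∈ Q, ∃ γ : SAW.DomainSAW Ω 1 a b, γ ∈ cls k π m σ ∧ γ.walk.support.map toZ2 = c := by
    intro c hc
    obtain ⟨γ, hγ⟩ := Census.exists_chord_of_mem_enum hB (hQL c hc)
    exact ⟨γ, (hmemQ γ).2 (hγ ▸ hc), hγ⟩
  -- linking ⟹ the up-sets are upper intervals of indices
  have hmonoA : ∀ i, i + 1 < No.length → (∃ γ ∈ cls k π m σ, γ ∈ A ∧ ι γ = i) →
      (∃ γ ∈ cls k π m σ, γ ∈ A ∧ ι γ = i + 1) := by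
    rintro i hi ⟨γ₀, h₀c, h₀A, h₀i⟩
    obtain ⟨c, hc, c', hc', hcu, hc'v, hlrc⟩ := linkedB_pair hlinkN i hi
    obtain ⟨γc, hγc, rfl⟩ := hreal c hc
    obtain ⟨γc', hγc', rfl⟩ := hreal c' hc'
    have hιc : ι γc = i := (hιeq γc hγc i (by omega)).2 (by rw [← hnxt, hcu, List.getD_eq_getElem _ _ (by omega)])
    have hιc' : ι γc' = i + 1 :=
      (hιeq γc' hγc' (i + 1) hi).2 (by rw [← hnxt, hc'v, List.getD_eq_getElem _ _ hi])
    have hAc : γc ∈ A := (hAι γ₀ h₀c γc hγc (h₀i.trans hιc.symm)).1 h₀A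
    exact ⟨γc', hγc', hAu γc γc' hγc hγc' (lr_of_lrCode hB hbox ha γc γc' hlrc) hAc, hιc'⟩
  have hmonoB : ∀ j, j + 1 < Wo.length → (∃ γ ∈ cls k π m σ, γ ∈ B ∧ κ γ = j) →
      (∃ γ ∈ cls k π m σ, γ ∈ B ∧ κ γ = j + 1) := by
    rintro j hj ⟨γ₀, h₀c, h₀B, h₀j⟩
    obtain ⟨c, hc, c', hc', hcu, hc'v, hlrc⟩ := linkedB_pair hlinkW j hj
    obtain ⟨γc, hγc, rfl⟩ := hreal c hc
    obtain ⟨γc', hγc', rfl⟩ := hreal c' hc'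
    have hκc : κ γc = j := (hκeq γc hγc j (by omega)).2 (by rw [← hprv, hcu, List.getD_eq_getElem _ _ (by omega)])
    have hκc' : κ γc' = j + 1 :=
      (hκeq γc' hγc' (j + 1) hj).2 (by rw [← hprv, hc'v, List.getD_eq_getElem _ _ hj])
    have hBc : γc ∈ B := (hBκ γ₀ h₀c γc hγc (h₀j.trans hκc.symm)).1 h₀B
    exact ⟨γc', hγc', hBu γc γc' hγc hγc' (lr_of_lrCode hB hbox ha γc γc' hlrc) hBc, hκc'⟩
  obtain ⟨t, ht⟩ := exists_threshold hmonoA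
  obtain ⟨t', ht'⟩ := exists_threshold hmonoB
  have hAt : ∀ γ ∈ cls k π m σ, (γ ∈ A ↔ t ≤ ι γ) := fun γ hγ => by
    rw [← ht (ι γ) (hιlt γ hγ)]
    exact ⟨fun h => ⟨γ, hγ, h, rfl⟩, fun ⟨γ', hγ', hA', he'⟩ => (hAι γ' hγ' γ hγ he').1 hA'⟩
  have hBt : ∀ γ ∈ cls k π m σ, (γ ∈ B ↔ t' ≤ κ γ) := fun γ hγ => by
    rw [← ht' (κ γ) (hκlt γ hγ)]
    exact ⟨fun h => ⟨γ, hγ, h, rfl⟩, fun ⟨γ', hγ', hB', he'⟩ => (hBκ γ' hγ' γ hγ he').1 hB'⟩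
  -- the end-step matrix
  set Mx : ℕ → ℕ → ℝ := fun i j =>
    ∑ γ ∈ univ.filter (fun γ => γ ∈ cls k π m σ ∧ ι γ = i ∧ κ γ = j), x ^ γ.length with hMxdef
  have hM0 : ∀ i j, 0 ≤ Mx i j := fun i j => sum_nonneg fun γ _ => pow_nonneg hx _
  have hMx : ∀ i j, i < No.length → j < Wo.length → Mx i j =
      evalR (realOf (entry (fun c => getV g.bz c (k + 1)) (fun c => getVR g.bz c (m + 1)) Q g.N
        (No.getD i g.bz) (Wo.getD j g.bz))) x := by
    intro i j hi hj
    set r : Code → Bool := fun c => decide (getV g.bz c (k + 1) = No.getD i g.bz) &&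
      decide (getVR g.bz c (m + 1) = Wo.getD j g.bz) with hr
    have hfil : Q.filter r = L.filter fun c => r c && (agreeOn (getVR g.bz) ce c 0 m && agreeOn (getV g.bz) ce c 0 k) := by
      rw [hQ, List.filter_filter]
    have hP : ∀ γ : SAW.DomainSAW Ω 1 a b, (γ ∈ cls k π m σ ∧ ι γ = i ∧ κ γ = j) ↔
        (r (γ.walk.support.map toZ2) && (agreeOn (getVR g.bz) ce (γ.walk.support.map toZ2) 0 m &&
          agreeOn (getV g.bz) ce (γ.walk.support.map toZ2) 0 k)) = true := by
      intro γ
      have hc : γ ∈ cls k π m σ ↔ (agreeOn (getVR g.bz) ce (γ.walk.support.map toZ2) 0 m &&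
          agreeOn (getV g.bz) ce (γ.walk.support.map toZ2) 0 k) = true := by
        rw [mem_cls_iff_code he γ, ← hbz, Bool.and_eq_true]; exact and_comm
      rw [Bool.and_eq_true, ← hc]
      constructor
      · rintro ⟨hγ, h1, h2⟩
        refine ⟨?_, hγ⟩
        simp only [hr, Bool.and_eq_true, decide_eq_true_eq, hnxt, hprv]
        exact ⟨(hιeq γ hγ i hi).1 h1, (hκeq γ hγ j hj).1 h2⟩
      · rintro ⟨h12, hγ⟩
        simp only [hr, Bool.and_eq_true, decide_eq_true_eq, hnxt, hprv] at h12
        exact ⟨hγ, (hιeq γ hγ i hi).2 h12.1, (hκeq γ hγ j hj).2 h12.2⟩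
    have key := sum_filter_eq_listSum hB hN hnodup (fun γ => γ ∈ cls k π m σ ∧ ι γ = i ∧ κ γ = j)
      (fun c => r c && (agreeOn (getVR g.bz) ce c 0 m && agreeOn (getV g.bz) ce c 0 k)) hP (fun n => x ^ n)
    have hb := Census.length_bounds_of_enum hB hN fun c => r c &&
      (agreeOn (getVR g.bz) ce c 0 m && agreeOn (getV g.bz) ce c 0 k)
    simp only [hMxdef]
    rw [key, entry, ← hr, hfil, hL, codes, Census.sum_pow_eq_census _ g.N hb, ← PolyCert.evalR_realOf_eq_sum]
  have hTP : ∀ i i' j j', i < i' → i' < No.length → j < j' → j' < Wo.length →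
      Mx i' j * Mx i j' ≤ Mx i' j' * Mx i j := by
    intro i i' j j' hi hi' hj hj'
    rw [hMx i' j hi' (by omega), hMx i j' (by omega) hj', hMx i' j' hi' hj', hMx i j (by omega) (by omega)]
    exact minorOK_sound hS (tp2OK_spec htp hi hi' hj hj') hle hlo hhi
  -- regrouping the sums over `Γ` into the matrix
  have regroup : ∀ I' J' : Finset ℕ,
      ∑ γ ∈ univ.filter (fun γ => γ ∈ cls k π m σ ∧ ι γ ∈ I' ∧ κ γ ∈ J'), x ^ γ.length =
        ∑ i ∈ I', ∑ j ∈ J', Mx i j := by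
    intro I' J'
    rw [← sum_product (I') (J') (fun ij => Mx ij.1 ij.2),
      ← sum_fiberwise_of_maps_to (s := univ.filter fun γ => γ ∈ cls k π m σ ∧ ι γ ∈ I' ∧ κ γ ∈ J')
        (t := I' ×ˢ J') (g := fun γ => (ι γ, κ γ)) (fun γ hγ => ?_)]
    · refine sum_congr rfl fun ij hij => ?_
      obtain ⟨hi, hj⟩ := mem_product.1 hij
      refine sum_congr ?_ fun _ _ => rfl
      ext γ
      simp only [mem_filter, mem_univ, true_and, Prod.ext_iff]
      constructor
      · rintro ⟨⟨hc, -, -⟩, h1, h2⟩; exact ⟨hc, h1, h2⟩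
      · rintro ⟨hc, h1, h2⟩; exact ⟨⟨hc, h1 ▸ hi, h2 ▸ hj⟩, h1, h2⟩
    · simp only [mem_filter, mem_univ, true_and] at hγ
      exact mem_product.2 ⟨hγ.2.1, hγ.2.2⟩
  -- the row/column index sets realised in `Sa`, `Sb`
  set I : Finset ℕ := (range No.length).filter fun i =>
    ∃ γ ∈ cls k π m σ, ι γ = i ∧ γ.walk.getVert (k + 1) ∈ Sa with hI
  set J : Finset ℕ := (range Wo.length).filter fun j =>
    ∃ γ ∈ cls k π m σ, κ γ = j ∧ γ.walk.reverse.getVert (m + 1) ∈ Sb with hJ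
  have hSa : ∀ γ ∈ cls k π m σ, (γ.walk.getVert (k + 1) ∈ Sa ↔ ι γ ∈ I) := fun γ hγ => by
    simp only [hI, mem_filter, mem_range]
    constructor
    · exact fun h => ⟨hιlt γ hγ, γ, hγ, rfl, h⟩
    · rintro ⟨-, γ', hγ', he', h'⟩
      have := toZ2_injective (((hιeq γ' hγ' _ (hιlt γ hγ)).1 he').trans ((hιeq γ hγ _ (hιlt γ hγ)).1 rfl).symm)
      rwa [this] at h'
  have hSb : ∀ γ ∈ cls k π m σ, (γ.walk.reverse.getVert (m + 1) ∈ Sb ↔ κ γ ∈ J) := fun γ hγ => by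
    simp only [hJ, mem_filter, mem_range]
    constructor
    · exact fun h => ⟨hκlt γ hγ, γ, hγ, rfl, h⟩
    · rintro ⟨-, γ', hγ', he', h'⟩
      have := toZ2_injective (((hκeq γ' hγ' _ (hκlt γ hγ)).1 he').trans ((hκeq γ hγ _ (hκlt γ hγ)).1 rfl).symm)
      rwa [this] at h'
  have e_s : s = univ.filter fun γ => γ ∈ cls k π m σ ∧ ι γ ∈ I ∧ κ γ ∈ J := by
    rw [hs]; ext γ
    simp only [mem_filter, mem_univ, true_and, restrP, Set.mem_setOf_eq]
    exact ⟨fun ⟨hc, h1, h2⟩ => ⟨hc, (hSa γ hc).1 h1, (hSb γ hc).1 h2⟩,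
      fun ⟨hc, h1, h2⟩ => ⟨hc, (hSa γ hc).2 h1, (hSb γ hc).2 h2⟩⟩
  have e_A : s.filter (· ∈ A) = univ.filter fun γ => γ ∈ cls k π m σ ∧ ι γ ∈ I.filter (t ≤ ·) ∧ κ γ ∈ J := by
    rw [e_s]; ext γ
    simp only [mem_filter, mem_univ, true_and]
    exact ⟨fun ⟨⟨hc, h1, h2⟩, hA⟩ => ⟨hc, ⟨h1, (hAt γ hc).1 hA⟩, h2⟩,
      fun ⟨hc, ⟨h1, ht1⟩, h2⟩ => ⟨⟨hc, h1, h2⟩, (hAt γ hc).2 ht1⟩⟩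
  have e_B : s.filter (· ∈ B) = univ.filter fun γ => γ ∈ cls k π m σ ∧ ι γ ∈ I ∧ κ γ ∈ J.filter (t' ≤ ·) := by
    rw [e_s]; ext γ
    simp only [mem_filter, mem_univ, true_and]
    exact ⟨fun ⟨⟨hc, h1, h2⟩, hB'⟩ => ⟨hc, h1, h2, (hBt γ hc).1 hB'⟩,
      fun ⟨hc, h1, h2, ht2⟩ => ⟨⟨hc, h1, h2⟩, (hBt γ hc).2 ht2⟩⟩
  have e_AB : (s.filter (· ∈ A)).filter (· ∈ B) =
      univ.filter fun γ => γ ∈ cls k π m σ ∧ ι γ ∈ I.filter (t ≤ ·) ∧ κ γ ∈ J.filter (t' ≤ ·) := by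
    rw [e_A]; ext γ
    simp only [mem_filter, mem_univ, true_and]
    exact ⟨fun ⟨⟨hc, h1, h2⟩, hB'⟩ => ⟨hc, h1, h2, (hBt γ hc).1 hB'⟩,
      fun ⟨hc, h1, h2, ht2⟩ => ⟨⟨hc, h1, h2⟩, (hBt γ hc).2 ht2⟩⟩
  rw [e_AB, e_A, e_B, e_s, regroup, regroup, regroup, regroup]
  exact block_of_tp2 Mx hM0 hTP I J (fun i hi => mem_range.1 (mem_filter.1 hi).1)
    (fun j hj => mem_range.1 (mem_filter.1 hj).1) t t'

end Main

end Summit.CriticalPhenomena.SAWScalingLimit.Theorems.LeftRightFKG.Negative.PAKit
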